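import Summits.CriticalPhenomena.PercolationContinuityZ3.Theorems.PercNearOneGluingNoHeavyLowerTailSahiE3AndOrExch2Generic
import Summits.CriticalPhenomena.PercolationContinuityZ3.Theorems.PercNearOneGluingNoHeavyLowerTailSahiE3AndOrExch2CaseB11
import Summits.CriticalPhenomena.PercolationContinuityZ3.Theorems.PercNearOneGluingNoHeavyLowerTailSahiE3AndOrExch2CaseB12
import Summits.CriticalPhenomena.PercolationContinuityZ3.Theorems.PercNearOneGluingNoHeavyLowerTailSahiE3AndOrExch2CaseB13
import Summits.CriticalPhenomena.PercolationContinuityZ3.Theorems.PercNearOneGluingNoHeavyLowerTailSahiE3AndOrExch2CaseB14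
import Summits.CriticalPhenomena.PercolationContinuityZ3.Theorems.PercNearOneGluingNoHeavyLowerTailSahiE3AndOrExch2CaseB15
import Mathlib.Tactic
import HarnessLib
import HarnessLib.Audit

/-!
# `NoHeavyLowerTail` (crux stmt-CriticalPhenomena-4575), Sahi programme P4: flagship block `x₀∧(x₁∨x₂)`, level-`∅` exchange lemma (bracket type 2, i.e. `D₂`) — dispatcher for K ∩ V = T2

Generated support file (cell `prim-l12`, seat P4, generation 23; generator HOME prim-l12-p4/code/gen23/asm/genasm.py;
`--supports stmt-CriticalPhenomena-4575`; tool lemmas of `…SahiE3AndOrTools` inlined in generation 26).  No named facts, no sorries; standard axioms; def-free.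
The level-`∅` exchange inequality `EXCH ≥ 0` (bracket type as in the title) of the OR-peel for the block `V = x₀∧(x₁∨x₂) ⊂ Bool³` (product weight
`μ = (A|1−A)(b|1−b)(c|1−c)`), for every configuration of up-sets `O ⊆ K∩L`, `K∪L ⊆ P` (and primed) and every certificate `R ≥ 0`
satisfying the pair inequalities of all admissible pairs (`hRpair`), is assembled by a case split on the traces `X ∩ V`
(memo FROM-prim-l12-p4-gen23-FLAGSHIP-LEVEL0.md §6): empty layers → `exchange_of_emptyLayer*`, no crossing →
`exchange_of_noCross₂/₁`, crossing with all four traces non-empty (60 patterns) → `exchange_of_hats` at the saturations + the trace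
polynomial `andorPolyNN_nonneg` (corners handled through `O ⊆ K∩L`).
-/

set_option maxRecDepth 400000
set_option linter.unusedSimpArgs false

namespace Summit.CriticalPhenomena.PercolationContinuityZ3.Theorems.SahiE3AndOrExch2

open Finset
open Summit.CriticalPhenomena.PercolationContinuityZ3.Theorems.SahiE3AndOrBlock
open scoped BigOperators

/-! Inlined copies (generation 26) of the tool lemmas of `…SahiE3AndOrTools` used below — that accepted module has had no
farm olean since 2026-08-23 (build-lane debt), so the assembly is made independent of it; the statements are verbatim. -/

/-- The crossing cell traced on `V`, in terms of the four traces: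
`((K \ L) ∩ (L' \ K')) ∩ V = ((K∩V) \ (L∩V)) ∩ ((L'∩V) \ (K'∩V))`. [this work] -/
private theorem xi_inter_V (K L L' K' : Finset (Fin 3 → Bool)) :
    ((K \ L) ∩ (L' \ K')) ∩ ({![true, true, false], ![true, false, true], ![true, true, true]} : Finset (Fin 3 → Bool))
      = ((K ∩ {![true, true, false], ![true, false, true], ![true, true, true]})
          \ (L ∩ {![true, true, false], ![true, false, true], ![true, true, true]}))
        ∩ ((L' ∩ {![true, true, false], ![true, false, true], ![true, true, true]})
          \ (K' ∩ {![true, true, false], ![true, false, true], ![true, true, true]})) := by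
  ext x; simp only [Finset.mem_inter, Finset.mem_sdiff]; tauto


/-- Dispatcher of the flagship level-`∅` assembly (bracket type 2) for `K ∩ V = T2`: splits on the traces of `L, K', L'` and calls the
branch lemmas. [this work] -/
theorem exch2_andor_KB (A b c : ℝ) (hA0 : 0 ≤ A) (hA1 : A ≤ 1) (hb0 : 0 ≤ b) (hb1 : b ≤ 1) (hc0 : 0 ≤ c) (hc1 : c ≤ 1)
    (μ : (Fin 3 → Bool) → ℝ) (hμ : ∀ x, μ x = (if x 0 then A else 1 - A) * ((if x 1 then b else 1 - b) * (if x 2 then c else 1 - c)))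
    (R : (Fin 3 → Bool) → ℝ) (hR0 : ∀ x, 0 ≤ R x)
    (hRpair : ∀ X Y : Finset (Fin 3 → Bool), (∀ a ∈ X, ∀ b : Fin 3 → Bool, a ≤ b → b ∈ X) → (∀ a ∈ Y, ∀ b : Fin 3 → Bool, a ≤ b → b ∈ Y) →
      (∑ x ∈ X, μ x) * (∑ x ∈ Y ∩ ({![true, true, false], ![true, false, true], ![true, true, true]} : Finset (Fin 3 → Bool)), μ x) + (∑ x ∈ Y, μ x) * (∑ x ∈ X ∩ ({![true, true, false], ![true, false, true], ![true, true, true]} : Finset (Fin 3 → Bool)), μ x) - (∑ x ∈ ({![true, true, false], ![true, false, true], ![true, true, true]} : Finset (Fin 3 → Bool)), μ x) * (∑ x ∈ X, μ x) * (∑ x ∈ Y, μ x)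
        ≤ ∑ x ∈ (X ∩ Y) ∩ ({![true, true, false], ![true, false, true], ![true, true, true]} : Finset (Fin 3 → Bool)), R x)
    (P K L O P' K' L' O' : Finset (Fin 3 → Bool))
    (hP : (∀ a ∈ P, ∀ b : Fin 3 → Bool, a ≤ b → b ∈ P)) (hK : (∀ a ∈ K, ∀ b : Fin 3 → Bool, a ≤ b → b ∈ K))
    (hL : (∀ a ∈ L, ∀ b : Fin 3 → Bool, a ≤ b → b ∈ L)) (hO : (∀ a ∈ O, ∀ b : Fin 3 → Bool, a ≤ b → b ∈ O))
    (hP' : (∀ a ∈ P', ∀ b : Fin 3 → Bool, a ≤ b → b ∈ P')) (hK' : (∀ a ∈ K', ∀ b : Fin 3 → Bool, a ≤ b → b ∈ K'))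
    (hL' : (∀ a ∈ L', ∀ b : Fin 3 → Bool, a ≤ b → b ∈ L')) (hO' : (∀ a ∈ O', ∀ b : Fin 3 → Bool, a ≤ b → b ∈ O'))
    (hKP : K ⊆ P) (hLP : L ⊆ P) (hOK : O ⊆ K) (hOL : O ⊆ L) (hKP' : K' ⊆ P') (hLP' : L' ⊆ P') (hOK' : O' ⊆ K') (hOL' : O' ⊆ L')
    (hTK : K ∩ ({![true, true, false], ![true, false, true], ![true, true, true]} : Finset (Fin 3 → Bool)) = ({![true, false, true], ![true, true, true]} : Finset (Fin 3 → Bool))) :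
    0 ≤ (∑ x ∈ (P ∩ P') ∩ ({![true, true, false], ![true, false, true], ![true, true, true]} : Finset (Fin 3 → Bool)), μ x) + (∑ x ∈ (O ∩ O') ∩ ({![true, true, false], ![true, false, true], ![true, true, true]} : Finset (Fin 3 → Bool)), μ x)
        - (∑ x ∈ P, μ x) * (∑ x ∈ O' ∩ ({![true, true, false], ![true, false, true], ![true, true, true]} : Finset (Fin 3 → Bool)), μ x) - (∑ x ∈ P', μ x) * (∑ x ∈ O ∩ ({![true, true, false], ![true, false, true], ![true, true, true]} : Finset (Fin 3 → Bool)), μ x)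
        + (∑ x ∈ (K ∩ K') ∩ ({![true, true, false], ![true, false, true], ![true, true, true]} : Finset (Fin 3 → Bool)), R x) + (∑ x ∈ (L ∩ L') ∩ ({![true, true, false], ![true, false, true], ![true, true, true]} : Finset (Fin 3 → Bool)), R x)
        - ((∑ x ∈ K, μ x) * (∑ x ∈ L' ∩ ({![true, true, false], ![true, false, true], ![true, true, true]} : Finset (Fin 3 → Bool)), μ x) + (∑ x ∈ L', μ x) * (∑ x ∈ K ∩ ({![true, true, false], ![true, false, true], ![true, true, true]} : Finset (Fin 3 → Bool)), μ x)
            - (∑ x ∈ ({![true, true, false], ![true, false, true], ![true, true, true]} : Finset (Fin 3 → Bool)), μ x) * (∑ x ∈ K, μ x) * (∑ x ∈ L', μ x))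
        - ((∑ x ∈ L, μ x) * (∑ x ∈ K' ∩ ({![true, true, false], ![true, false, true], ![true, true, true]} : Finset (Fin 3 → Bool)), μ x) + (∑ x ∈ K', μ x) * (∑ x ∈ L ∩ ({![true, true, false], ![true, false, true], ![true, true, true]} : Finset (Fin 3 → Bool)), μ x)
            - (∑ x ∈ ({![true, true, false], ![true, false, true], ![true, true, true]} : Finset (Fin 3 → Bool)), μ x) * (∑ x ∈ L, μ x) * (∑ x ∈ K', μ x))
        + (1 - ∑ x ∈ ({![true, true, false], ![true, false, true], ![true, true, true]} : Finset (Fin 3 → Bool)), μ x) * (((∑ x ∈ P ∩ P', μ x) - (∑ x ∈ P, μ x) * (∑ x ∈ P', μ x))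
            + ((∑ x ∈ P, μ x) - ∑ x ∈ K, μ x) * ((∑ x ∈ P', μ x) - ∑ x ∈ L', μ x)
            + ((∑ x ∈ P, μ x) - ∑ x ∈ L, μ x) * ((∑ x ∈ P', μ x) - ∑ x ∈ K', μ x)) := by
  have eL := br2_emptyL A b c hA0 hA1 hb0 hb1 hc0 hc1 μ hμ R hR0 hRpair P K L O P' K' L' O' hP hK hL hO hP' hK' hL' hO' hKP hLP hOK hOL hKP' hLP' hOK' hOL'
  have eKp := br2_emptyKp A b c hA0 hA1 hb0 hb1 hc0 hc1 μ hμ R hR0 hRpair P K L O P' K' L' O' hP hK hL hO hP' hK' hL' hO' hKP hLP hOK hOL hKP' hLP' hOK' hOL'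
  have eLp := br2_emptyLp A b c hA0 hA1 hb0 hb1 hc0 hc1 μ hμ R hR0 hRpair P K L O P' K' L' O' hP hK hL hO hP' hK' hL' hO' hKP hLP hOK hOL hKP' hLP' hOK' hOL'
  have nc := br2_noCross A b c hA0 hA1 hb0 hb1 hc0 hc1 μ hμ R hR0 hRpair P K L O P' K' L' O' hP hK hL hO hP' hK' hL' hO' hKP hLP hOK hOL hKP' hLP' hOK' hOL'
  have cBPx_PBx := br2_BPx_PBx A b c hA0 hA1 hb0 hb1 hc0 hc1 μ hμ R hR0 hRpair P K L O P' K' L' O' hP hK hL hO hP' hK' hL' hO' hKP hLP hOK hOL hKP' hLP' hOK' hOL'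
  have cBPx_PVx := br2_BPx_PVx A b c hA0 hA1 hb0 hb1 hc0 hc1 μ hμ R hR0 hRpair P K L O P' K' L' O' hP hK hL hO hP' hK' hL' hO' hKP hLP hOK hOL hKP' hLP' hOK' hOL'
  have cBPx_ABx := br2_BPx_ABx A b c hA0 hA1 hb0 hb1 hc0 hc1 μ hμ R hR0 hRpair P K L O P' K' L' O' hP hK hL hO hP' hK' hL' hO' hKP hLP hOK hOL hKP' hLP' hOK' hOL'
  have cBPx_AVx := br2_BPx_AVx A b c hA0 hA1 hb0 hb1 hc0 hc1 μ hμ R hR0 hRpair P K L O P' K' L' O' hP hK hL hO hP' hK' hL' hO' hKP hLP hOK hOL hKP' hLP' hOK' hOL'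
  have cBAx_PBx := br2_BAx_PBx A b c hA0 hA1 hb0 hb1 hc0 hc1 μ hμ R hR0 hRpair P K L O P' K' L' O' hP hK hL hO hP' hK' hL' hO' hKP hLP hOK hOL hKP' hLP' hOK' hOL'
  have cBAx_PVx := br2_BAx_PVx A b c hA0 hA1 hb0 hb1 hc0 hc1 μ hμ R hR0 hRpair P K L O P' K' L' O' hP hK hL hO hP' hK' hL' hO' hKP hLP hOK hOL hKP' hLP' hOK' hOL'
  have cBAx_APx := br2_BAx_APx A b c hA0 hA1 hb0 hb1 hc0 hc1 μ hμ R hR0 hRpair P K L O P' K' L' O' hP hK hL hO hP' hK' hL' hO' hKP hLP hOK hOL hKP' hLP' hOK' hOL'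
  have cBAx_ABx := br2_BAx_ABx A b c hA0 hA1 hb0 hb1 hc0 hc1 μ hμ R hR0 hRpair P K L O P' K' L' O' hP hK hL hO hP' hK' hL' hO' hKP hLP hOK hOL hKP' hLP' hOK' hOL'
  have cBAx_AVx := br2_BAx_AVx A b c hA0 hA1 hb0 hb1 hc0 hc1 μ hμ R hR0 hRpair P K L O P' K' L' O' hP hK hL hO hP' hK' hL' hO' hKP hLP hOK hOL hKP' hLP' hOK' hOL'
  have cBAx_VPx := br2_BAx_VPx A b c hA0 hA1 hb0 hb1 hc0 hc1 μ hμ R hR0 hRpair P K L O P' K' L' O' hP hK hL hO hP' hK' hL' hO' hKP hLP hOK hOL hKP' hLP' hOK' hOL'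
  have cBAx_VBx := br2_BAx_VBx A b c hA0 hA1 hb0 hb1 hc0 hc1 μ hμ R hR0 hRpair P K L O P' K' L' O' hP hK hL hO hP' hK' hL' hO' hKP hLP hOK hOL hKP' hLP' hOK' hOL'
  have cBVx_APx := br2_BVx_APx A b c hA0 hA1 hb0 hb1 hc0 hc1 μ hμ R hR0 hRpair P K L O P' K' L' O' hP hK hL hO hP' hK' hL' hO' hKP hLP hOK hOL hKP' hLP' hOK' hOL'
  have cBVx_ABx := br2_BVx_ABx A b c hA0 hA1 hb0 hb1 hc0 hc1 μ hμ R hR0 hRpair P K L O P' K' L' O' hP hK hL hO hP' hK' hL' hO' hKP hLP hOK hOL hKP' hLP' hOK' hOL'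
  have cBVx_VPx := br2_BVx_VPx A b c hA0 hA1 hb0 hb1 hc0 hc1 μ hμ R hR0 hRpair P K L O P' K' L' O' hP hK hL hO hP' hK' hL' hO' hKP hLP hOK hOL hKP' hLP' hOK' hOL'
  have cBVx_VBx := br2_BVx_VBx A b c hA0 hA1 hb0 hb1 hc0 hc1 μ hμ R hR0 hRpair P K L O P' K' L' O' hP hK hL hO hP' hK' hL' hO' hKP hLP hOK hOL hKP' hLP' hOK' hOL'
  rcases trace_cases L hL with hTL | hTL | hTL | hTL | hTL <;> rcases trace_cases K' hK' with hTK' | hTK' | hTK' | hTK' | hTK' <;>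
    rcases trace_cases L' hL' with hTL' | hTL' | hTL' | hTL' | hTL'
  all_goals first
    | exact eL hTL
    | exact eKp hTK'
    | exact eLp hTL'
    | exact nc (by rw [xi_inter_V K L L' K', hTK, hTL, hTK', hTL']; decide) (by rw [xi_inter_V L K K' L', hTL, hTK, hTL', hTK']; decide)
    | exact cBPx_PBx hTK hTL hTK' hTL'
    | exact cBPx_PVx hTK hTL hTK' hTL'
    | exact cBPx_ABx hTK hTL hTK' hTL'
    | exact cBPx_AVx hTK hTL hTK' hTL'
    | exact cBAx_PBx hTK hTL hTK' hTL'
    | exact cBAx_PVx hTK hTL hTK' hTL'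
    | exact cBAx_APx hTK hTL hTK' hTL'
    | exact cBAx_ABx hTK hTL hTK' hTL'
    | exact cBAx_AVx hTK hTL hTK' hTL'
    | exact cBAx_VPx hTK hTL hTK' hTL'
    | exact cBAx_VBx hTK hTL hTK' hTL'
    | exact cBVx_APx hTK hTL hTK' hTL'
    | exact cBVx_ABx hTK hTL hTK' hTL'
    | exact cBVx_VPx hTK hTL hTK' hTL'
    | exact cBVx_VBx hTK hTL hTK' hTL'

end Summit.CriticalPhenomena.PercolationContinuityZ3.Theorems.SahiE3AndOrExch2
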